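import Summits.QuantumAdvantage.QuantumAdvantage.Theorems.LinnikCubicClassGroupsDegreeOnePrimesEscapeCosetPNTAsymptotic
import Summits.QuantumAdvantage.QuantumAdvantage.Theorems.LinnikCubicClassGroupsDegreeOnePrimesEscapeBinaryFormPrimes
import Literature.NumberTheory.QuadraticFields.PrimesRepresentedDensity
import HarnessLib

/-!
# The prime number theorem for a positive definite binary quadratic form: `π_Q(x) ∼ δ_Q Li(x)`,
# `δ_Q = 1/(2h(D))` or `1/h(D)` (de la Vallée Poussin 1897, Landau 1918; the natural-density form of Cox, Thm. 9.12)

Topic `Summits/QuantumAdvantage/QuantumAdvantage/Theorems`, cell B2b-1 (linnik-cubic), PART A (gen 39); helper toward the crux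
`DegreeOnePrimesEscape` (stmt-QuantumAdvantage-11543) of route `LinnikCubicClassGroups`.  HONEST FRAMING: the value of this file is a
THEOREM (kernel-checked, unconditional) — NOT summit progress (the route still rests on the hypothesis-type target `PureCubicClassNumberHard`).

For a primitive positive definite form `Q` of discriminant `D = f² d_K` with ring class `τ = [𝔄_Q] ∈ I_K(f)/P_{K,ℤ}(f)`, the count
`#{𝔭 : N𝔭 = p, [𝔭] ∈ {τ, τ⁻¹}} = 2·[Q represents p]` (`p ∤ f d_K`, tree `RingClass.primeNormCount_repSet_eq`) gives
`|#{𝔭 : [𝔭] ∈ {τ,τ⁻¹}, N𝔭 = p ≤ x prime} − 2π_Q(x)| ≤ 6(f|d_K| + 1)` (`abs_ncard_repSet_sub_two_mul_card_le`); with Landau's prime ideal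
theorem for ring classes in asymptotic form (`tendsto_ncard_fiber_degOne_div_offsetLogIntegral`, sibling file) this yields
**`π_Q(x) ∼ (#{τ, τ⁻¹}/(2h(D))) Li(x)`**: the natural density of the primes represented by `Q` is `1/(2h(D))` if `Q` is properly equivalent to
its opposite and `1/h(D)` otherwise (`tendsto_card_primesRepresented_div_offsetLogIntegral`) — the natural-density strengthening of the
Dirichlet-density statement `RingClass.hasDirichletDensity_setOf_represented` (Cox Thm. 9.12, tree).

## References
* D. A. Cox, *Primes of the form x² + ny²*, 2nd ed., Wiley (2013), §9.B Thm. 9.12. [Cox2013]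
* E. Landau, *Über Ideale und Primideale in Idealklassen*, Math. Z. 2 (1918) 52–154. [Landau1918Idealklassen]
-/

noncomputable section

open Complex Real Set Filter Topology NumberField IsDedekindDomain Module Asymptotics
open scoped NumberField nonZeroDivisors QuadraticAlgebra

namespace Summit.QuantumAdvantage.QuantumAdvantage.Theorems.DegreeOnePrimesEscape

open Literature.NumberTheory.LFunctions Literature.NumberTheory.LFunctions.NumberField
  Literature.NumberTheory.LFunctions.AbelianDensity Literature.NumberTheory.GaloisRepresentations
open Literature.NumberTheory.NumberFields Literature.NumberTheory.NumberFields.RingClassField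
open Literature.NumberTheory.QuadraticFields Literature.NumberTheory.QuadraticFields.RingClass
open Literature.NumberTheory.QuadraticFields.Quadratic Literature.NumberTheory.QuadraticFields.Quadratic.BinQF
open Literature.NumberTheory.EllipticCurves
open Literature.Computability.Cryptography.Hallgren2005.OrderCl
open scoped Classical

/-! ### Counting primes represented by a form against degree-one primes in the two ring classes `τ, τ⁻¹` -/

section Counting

variable {K : Type} [Field K] [NumberField K]
variable (b : Basis (Fin 2) ℤ (𝓞 K)) (hb : b 0 = 1) {t m : ℤ}
  (hω : b 1 * b 1 = (m : 𝓞 K) + (t : 𝓞 K) * b 1)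
variable {f : ℕ} {Δ : NegDiscr} {s : ℤ}
  (hD : Δ.D = (f : ℤ) ^ 2 * (t ^ 2 + 4 * m)) (hs : 2 * s = Δ.D - f * t)
variable (ι : QO Δ →+* 𝓞 K) (hι : ι QuadraticAlgebra.omega = (f : 𝓞 K) * b 1 + (s : 𝓞 K))

omit [NumberField K] in
/-- The card of a filtered `primesOfNorm` is the tree's `primeNormCount` (any decidability instance). -/
theorem card_filter_primesOfNorm_eq [NumberField K] (X : Set (HeightOneSpectrum (𝓞 K))) (p : ℕ)
    (inst : DecidablePred (· ∈ X)) :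
    (@Finset.filter _ (· ∈ X) inst (primesOfNorm K p)).card = primeNormCount K X p := by
  unfold primeNormCount
  congr

include hb hω hD hs hι in
/-- **`|#{𝔭 : [𝔭] ∈ {τ, τ⁻¹}, N𝔭 = p ≤ x prime} − 2 π_Q(x)| ≤ 6 (f|d_K| + 1)`**: summing the count
`#{𝔭 : N𝔭 = p, [𝔭] ∈ {τ,τ⁻¹}} = 2·[Q represents p]` over the primes `p ≤ x`, `p ∤ f d_K` (the primes `p ∣ f d_K` contribute at
most `6` each). [cite: Cox2013, §9.B Thm. 9.12 (proof)] -/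
theorem abs_ncard_repSet_sub_two_mul_card_le (hf : f ≠ 0) {Q : BinQF} (hQ : Q.IsPosPrim Δ.D) (hQa : IsCoprime Q.a (f : ℤ))
    (h2 : finrank ℚ K = 2)
    {τ : RingClassGroup K f} (hτ : τ = QuotientGroup.mk ⟨_, mk0_map_fIdeal_mem ι hQ hQa⟩) {x : ℝ} (hx : 0 ≤ x) :
    |(({v : HeightOneSpectrum (𝓞 K) | ¬ Ideal.span {(f : 𝓞 K)} ≤ v.asIdeal ∧ (primeClass f v = τ ∨ primeClass f v = τ⁻¹) ∧
          (Ideal.absNorm v.asIdeal).Prime ∧ (Ideal.absNorm v.asIdeal : ℝ) ≤ x}.ncard : ℕ) : ℝ) -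
        2 * ((((Finset.range (⌊x⌋₊ + 1)).filter Nat.Prime).filter (fun p : ℕ => ∃ a c : ℤ, Q.eval a c = (p : ℤ))).card : ℕ)| ≤
      6 * ((f * (NumberField.discr K).natAbs : ℕ) + 1 : ℝ) := by
  set X : Set (HeightOneSpectrum (𝓞 K)) :=
    {v | ¬ Ideal.span {(f : 𝓞 K)} ≤ v.asIdeal ∧ (primeClass f v = τ ∨ primeClass f v = τ⁻¹)} with hX
  set Px : Finset ℕ := (Finset.range (⌊x⌋₊ + 1)).filter Nat.Prime with hPx
  set N : ℕ := f * (NumberField.discr K).natAbs with hN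
  have hN0 : N ≠ 0 := mul_ne_zero hf (Int.natAbs_ne_zero.mpr (NumberField.discr_ne_zero K))
  -- (1) the set of degree-one primes as a disjoint union over the primes `p ≤ x`
  have hmemPx : ∀ p : ℕ, p ∈ Px ↔ p.Prime ∧ (p : ℝ) ≤ x := by
    intro p
    rw [hPx, Finset.mem_filter, Finset.mem_range, Nat.lt_succ_iff, Nat.le_floor_iff hx]
    tauto
  have hV : {v : HeightOneSpectrum (𝓞 K) | ¬ Ideal.span {(f : 𝓞 K)} ≤ v.asIdeal ∧ (primeClass f v = τ ∨ primeClass f v = τ⁻¹) ∧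
        (Ideal.absNorm v.asIdeal).Prime ∧ (Ideal.absNorm v.asIdeal : ℝ) ≤ x} =
      ↑(Px.biUnion fun p => (primesOfNorm K p).filter (· ∈ X)) := by
    ext v
    simp only [Set.mem_setOf_eq, Finset.coe_biUnion, Finset.mem_coe, Set.mem_iUnion, Finset.mem_filter,
      mem_primesOfNorm, exists_prop]
    constructor
    · rintro ⟨hm, hc, hpr, hle⟩
      exact ⟨Ideal.absNorm v.asIdeal, (hmemPx _).2 ⟨hpr, hle⟩, rfl, ⟨hm, hc⟩⟩
    · rintro ⟨p, hp, hvp, hvX⟩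
      obtain ⟨hpr, hle⟩ := (hmemPx p).1 hp
      exact ⟨hvX.1, hvX.2, hvp ▸ hpr, by rw [hvp]; exact hle⟩
  have hdisj : (Px : Set ℕ).PairwiseDisjoint fun p => (primesOfNorm K p).filter (· ∈ X) := by
    intro p _ q _ hpq
    rw [Function.onFun, Finset.disjoint_left]
    intro v hvp hvq
    rw [Finset.mem_filter, mem_primesOfNorm] at hvp hvq
    exact hpq (hvp.1.symm.trans hvq.1)
  have hcardV : ({v : HeightOneSpectrum (𝓞 K) | ¬ Ideal.span {(f : 𝓞 K)} ≤ v.asIdeal ∧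
        (primeClass f v = τ ∨ primeClass f v = τ⁻¹) ∧
        (Ideal.absNorm v.asIdeal).Prime ∧ (Ideal.absNorm v.asIdeal : ℝ) ≤ x}.ncard : ℝ) =
      ∑ p ∈ Px, (primeNormCount K X p : ℝ) := by
    rw [hV, Set.ncard_coe_finset, Finset.card_biUnion hdisj]
    push_cast
    refine Finset.sum_congr rfl fun p _ ↦ ?_
    rw [card_filter_primesOfNorm_eq X p _]
  -- (2) `2 π_Q(x)` as a sum of indicators
  have hcardR : (2 : ℝ) * ((Px.filter (fun p : ℕ => ∃ a c : ℤ, Q.eval a c = (p : ℤ))).card : ℕ) =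
      ∑ p ∈ Px, (if ∃ a c : ℤ, Q.eval a c = p then (2 : ℝ) else 0) := by
    rw [Finset.card_filter, Nat.cast_sum, Finset.mul_sum]
    refine Finset.sum_congr rfl fun p _ ↦ ?_
    split_ifs <;> simp
  rw [hcardV, hcardR, ← Finset.sum_sub_distrib]
  -- (3) the terms vanish off `p ∣ f d_K`
  have hzero : ∀ p ∈ Px, ¬ p ∣ N → (primeNormCount K X p : ℝ) - (if ∃ a c : ℤ, Q.eval a c = p then (2 : ℝ) else 0) = 0 := by
    intro p hp hpN
    have hpr := ((hmemPx p).1 hp).1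
    have hpf : ¬ (p : ℤ) ∣ (f : ℤ) := fun h => hpN ((Int.natCast_dvd_natCast.mp h).mul_right _)
    have hpd : ¬ (p : ℤ) ∣ NumberField.discr K := fun h => hpN (Dvd.dvd.mul_left (Int.natCast_dvd.mp h) _)
    rw [primeNormCount_repSet_eq b hb hω hD hs ι hι hf hQ hQa hτ hpr hpf hpd]
    split_ifs <;> simp
  rw [← Finset.sum_filter_add_sum_filter_not Px (fun p => p ∣ N)]
  have hz : ∑ p ∈ Px.filter (fun p => ¬ p ∣ N),
      ((primeNormCount K X p : ℝ) - (if ∃ a c : ℤ, Q.eval a c = p then (2 : ℝ) else 0)) = 0 :=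
    Finset.sum_eq_zero fun p hp => hzero p (Finset.mem_filter.1 hp).1 (Finset.mem_filter.1 hp).2
  rw [hz, add_zero]
  -- (4) the remaining terms: at most `N + 1` of them, each `≤ 6` in absolute value
  have hr : finrank ℚ K = 2 := h2
  have hterm : ∀ p ∈ Px.filter (fun p => p ∣ N),
      |(primeNormCount K X p : ℝ) - (if ∃ a c : ℤ, Q.eval a c = p then (2 : ℝ) else 0)| ≤ 6 := by
    intro p hp
    have hpr : p.Prime := ((hmemPx p).1 (Finset.mem_filter.1 hp).1).1
    have hcnt : |(primeNormCount K X p : ℝ)| ≤ 4 := by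
      have := abs_primeNormCount_le X ⟨p, hpr⟩
      rw [hr] at this
      norm_num at this
      rw [abs_of_nonneg (Nat.cast_nonneg _)]
      exact_mod_cast this
    have h2' : |(if ∃ a c : ℤ, Q.eval a c = p then (2 : ℝ) else 0)| ≤ 2 := by split_ifs <;> simp
    calc _ ≤ |(primeNormCount K X p : ℝ)| + |(if ∃ a c : ℤ, Q.eval a c = p then (2 : ℝ) else 0)| := abs_sub _ _
      _ ≤ 4 + 2 := add_le_add hcnt h2'
      _ = 6 := by norm_num
  have hcount : ((Px.filter (fun p => p ∣ N)).card : ℝ) ≤ (N : ℝ) + 1 := by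
    have hsub : Px.filter (fun p => p ∣ N) ⊆ Finset.range (N + 1) := by
      intro p hp
      rw [Finset.mem_filter] at hp
      rw [Finset.mem_range, Nat.lt_succ_iff]
      exact Nat.le_of_dvd (Nat.pos_of_ne_zero hN0) hp.2
    have := Finset.card_le_card hsub
    rw [Finset.card_range] at this
    exact_mod_cast this
  calc |∑ p ∈ Px.filter (fun p => p ∣ N), ((primeNormCount K X p : ℝ) - (if ∃ a c : ℤ, Q.eval a c = p then (2 : ℝ) else 0))|
      ≤ ∑ p ∈ Px.filter (fun p => p ∣ N), |(primeNormCount K X p : ℝ) - (if ∃ a c : ℤ, Q.eval a c = p then (2 : ℝ) else 0)| :=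
        Finset.abs_sum_le_sum_abs _ _
    _ ≤ ∑ _p ∈ Px.filter (fun p => p ∣ N), (6 : ℝ) := Finset.sum_le_sum hterm
    _ = 6 * ((Px.filter (fun p => p ∣ N)).card : ℝ) := by rw [Finset.sum_const, nsmul_eq_mul, mul_comm]
    _ ≤ 6 * ((N : ℝ) + 1) := by gcongr
    _ = 6 * ((f * (NumberField.discr K).natAbs : ℕ) + 1 : ℝ) := by rw [hN]

end Counting

/-! ### The prime number theorem for a positive definite binary quadratic form -/

/-- Properly equivalent forms represent the same primes `≤ x`. -/
theorem filter_represented_eq_of_properEquiv {Q Q' : BinQF} (h : Q.ProperEquiv Q') (S : Finset ℕ) :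
    S.filter (fun p : ℕ => ∃ a c : ℤ, Q.eval a c = (p : ℤ)) = S.filter (fun p : ℕ => ∃ a c : ℤ, Q'.eval a c = (p : ℤ)) :=
  Finset.filter_congr fun _ _ => ⟨fun hp => h.exists_eval_eq hp, fun hp => h.symm.exists_eval_eq hp⟩

/-- **THE PRIME NUMBER THEOREM FOR A POSITIVE DEFINITE BINARY QUADRATIC FORM** (de la Vallée Poussin 1897 / Landau; the
natural-density form of Cox, Thm. 9.12): for a primitive positive definite form `Q` of discriminant `D < 0`,
`π_Q(x) = #{p ≤ x prime : p = Q(a, c) for some a, c ∈ ℤ} ∼ δ_Q · Li(x)` with `δ_Q = 1/(2h(D))` if `Q` is properly equivalent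
to its opposite `(a, −b, c)` and `δ_Q = 1/h(D)` otherwise (`h(D) = BinaryQuadraticForm.classNumber D`).  Unconditional.
[cite: Cox2013, §9.B Thm. 9.12] [cite: Landau1918Idealklassen, §1 Satz] -/
theorem tendsto_card_primesRepresented_div_offsetLogIntegral {D : ℤ} (hD : D < 0) {Q : BinQF} (hQ : Q.IsPosPrim D) :
    Tendsto (fun x : ℝ ↦ (((((Finset.range (⌊x⌋₊ + 1)).filter Nat.Prime).filter
        (fun p : ℕ => ∃ a c : ℤ, Q.eval a c = (p : ℤ))).card : ℕ) : ℝ) / offsetLogIntegral x) atTop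
      (𝓝 (if Q.ProperEquiv (negForm Q) then 1 / (2 * (BinaryQuadraticForm.classNumber D : ℝ))
        else 1 / (BinaryQuadraticForm.classNumber D : ℝ))) := by
  obtain ⟨K, _, _, h2, hneg, f, hf, hDf⟩ := BinaryQuadraticForm.exists_quadraticField_of_neg hD hQ.emod_four
  have hK : IsImaginaryQuadratic K := isImaginaryQuadratic_iff_discr_neg.mpr ⟨h2, hneg⟩
  -- the order data
  obtain ⟨b, hb⟩ := exists_basis_zero_eq_one h2
  set m : ℤ := b.repr (b 1 * b 1) 0 with hm
  set t : ℤ := b.repr (b 1 * b 1) 1 with ht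
  have hω : b 1 * b 1 = (m : 𝓞 K) + (t : 𝓞 K) * b 1 := basis_one_mul_self_eq b hb
  have hdK : NumberField.discr K = t ^ 2 + 4 * m := discr_eq_sq_add_four_mul b hb
  set Δ : NegDiscr := ⟨D, hD⟩ with hΔ
  have hDΔ : Δ.D = (f : ℤ) ^ 2 * (t ^ 2 + 4 * m) := by simp only [hΔ]; rw [hDf, hdK]
  obtain ⟨s, hs'⟩ := two_dvd_sub hDΔ
  have hs : 2 * s = Δ.D - f * t := hs'.symm
  obtain ⟨ι, hι⟩ := exists_ringHom b hω hDΔ hs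
  haveI : Finite (RingClassGroup K f) := finite_ringClassGroup h2 hf
  have hfZ : (f : ℤ) ≠ 0 := by exact_mod_cast hf
  have hQΔ : Q.IsPosPrim Δ.D := hQ
  obtain ⟨Q', hQQ', hQ', hQ'a⟩ := exists_properEquiv_isPosPrim_isCoprime_a Δ.neg hQΔ hfZ
  set τ : RingClassGroup K f := QuotientGroup.mk ⟨_, mk0_map_fIdeal_mem ι hQ' hQ'a⟩ with hτ
  set 𝔪 : Ideal (𝓞 K) := Ideal.span {(f : 𝓞 K)} with h𝔪def
  have h𝔪 : 𝔪 ≠ ⊥ := span_natCast_ne_bot' (K := K) hf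
  have hG := natCard_ringClassGroup_le_rayCondQ_pow hK hf
  set hcl : ℝ := (Nat.card (RingClassGroup K f) : ℝ) with hhcl
  have hcard : hcl = BinaryQuadraticForm.classNumber D := by
    rw [hhcl, card_ringClassGroup_eq_classNumber hK hf, ← hDf]
  have hcl0 : 0 < hcl := by rw [hhcl]; exact_mod_cast Nat.card_pos
  -- the degree-one fibre counts `D_c(x)` and their limits
  set Dg : RingClassGroup K f → ℝ → ℝ := fun c x ↦ (({v : HeightOneSpectrum (𝓞 K) | ¬ 𝔪 ≤ v.asIdeal ∧ primeClass f v = c ∧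
      (Ideal.absNorm v.asIdeal).Prime ∧ (Ideal.absNorm v.asIdeal : ℝ) ≤ x}.ncard : ℕ) : ℝ) with hDg
  have hlim : ∀ c : RingClassGroup K f, Tendsto (fun x ↦ Dg c x / offsetLogIntegral x) atTop (𝓝 (1 / hcl)) := fun c ↦
    tendsto_ncard_fiber_degOne_div_offsetLogIntegral 2 one_lt_two K h2 (RingClassGroup K f) 𝔪 (primeClass f) h𝔪
      (artinKillsRay_primeClass f) (fun χ hχ ↦ exists_charFun_primeClass_ne_one f χ hχ) hG c
  -- `V(x)` = degree-one primes with class in `{τ, τ⁻¹}`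
  set V : ℝ → ℝ := fun x ↦ (({v : HeightOneSpectrum (𝓞 K) | ¬ Ideal.span {(f : 𝓞 K)} ≤ v.asIdeal ∧
      (primeClass f v = τ ∨ primeClass f v = τ⁻¹) ∧
      (Ideal.absNorm v.asIdeal).Prime ∧ (Ideal.absNorm v.asIdeal : ℝ) ≤ x}.ncard : ℕ) : ℝ) with hV
  set S : Finset (RingClassGroup K f) := {τ, τ⁻¹} with hS
  have hVlim : Tendsto (fun x ↦ V x / offsetLogIntegral x) atTop (𝓝 ((S.card : ℝ) / hcl)) := by
    by_cases heq : τ = τ⁻¹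
    · have hS1 : S = {τ} := by rw [hS, ← heq]; exact Finset.insert_eq_of_mem (Finset.mem_singleton_self τ)
      have hVD : ∀ x, V x = Dg τ x := by
        intro x
        simp only [hV, hDg, h𝔪def]
        congr 3
        ext v
        simp only [← heq, or_self]
      rw [hS1, Finset.card_singleton, Nat.cast_one]
      simp_rw [hVD]
      exact hlim τ
    · have hS2 : S.card = 2 := Finset.card_pair heq
      have hVD : ∀ x, V x = Dg τ x + Dg τ⁻¹ x := by
        intro x
        simp only [hV, hDg, h𝔪def]
        have hfin : ∀ c : RingClassGroup K f, ({v : HeightOneSpectrum (𝓞 K) | ¬ Ideal.span {(f : 𝓞 K)} ≤ v.asIdeal ∧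
            primeClass f v = c ∧ (Ideal.absNorm v.asIdeal).Prime ∧ (Ideal.absNorm v.asIdeal : ℝ) ≤ x}).Finite :=
          fun c ↦ (finite_setOf_absNorm_le K x).subset fun v hv ↦ hv.2.2.2
        have hdisj : Disjoint {v : HeightOneSpectrum (𝓞 K) | ¬ Ideal.span {(f : 𝓞 K)} ≤ v.asIdeal ∧
            primeClass f v = τ ∧ (Ideal.absNorm v.asIdeal).Prime ∧ (Ideal.absNorm v.asIdeal : ℝ) ≤ x}
            {v : HeightOneSpectrum (𝓞 K) | ¬ Ideal.span {(f : 𝓞 K)} ≤ v.asIdeal ∧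
            primeClass f v = τ⁻¹ ∧ (Ideal.absNorm v.asIdeal).Prime ∧ (Ideal.absNorm v.asIdeal : ℝ) ≤ x} := by
          rw [Set.disjoint_left]
          rintro v ⟨-, hv, -⟩ ⟨-, hv', -⟩
          exact heq (hv.symm.trans hv')
        rw [← Nat.cast_add, ← Set.ncard_union_eq hdisj (hfin τ) (hfin τ⁻¹)]
        congr 2
        ext v
        simp only [Set.mem_setOf_eq, Set.mem_union]
        tauto
      rw [hS2, Nat.cast_two]
      simp_rw [hVD, add_div]
      have := (hlim τ).add (hlim τ⁻¹)
      convert this using 2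
      ring
  -- `2 π_Q(x) = V(x) − E(x)` with `|E(x)| ≤ C`
  set πQ : ℝ → ℝ := fun x ↦ (((((Finset.range (⌊x⌋₊ + 1)).filter Nat.Prime).filter
      (fun p : ℕ => ∃ a c : ℤ, Q'.eval a c = (p : ℤ))).card : ℕ) : ℝ) with hπQ
  set C : ℝ := 6 * ((f * (NumberField.discr K).natAbs : ℕ) + 1 : ℝ) with hC
  have hE : ∀ x : ℝ, 0 ≤ x → |V x - 2 * πQ x| ≤ C := fun x hx ↦
    abs_ncard_repSet_sub_two_mul_card_le b hb hω hDΔ hs ι hι hf hQ' hQ'a h2 hτ hx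
  have hLi := tendsto_offsetLogIntegral_atTop
  have hCLi : Tendsto (fun x : ℝ ↦ C / offsetLogIntegral x) atTop (𝓝 0) := hLi.const_div_atTop C
  have hCLi' : Tendsto (fun x : ℝ ↦ -(C / offsetLogIntegral x)) atTop (𝓝 0) := by simpa using hCLi.neg
  have hElim : Tendsto (fun x ↦ (V x - 2 * πQ x) / offsetLogIntegral x) atTop (𝓝 0) := by
    refine tendsto_of_tendsto_of_tendsto_of_le_of_le' hCLi' hCLi ?_ ?_
    · filter_upwards [eventually_ge_atTop (256 : ℝ)] with x hx
      have hLipos : 0 < offsetLogIntegral x := lt_of_lt_of_le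
        (div_pos (by linarith) (by have := Real.log_pos (by linarith : (1:ℝ) < x); positivity))
        (div_two_mul_log_le_offsetLogIntegral hx)
      rw [neg_le, ← neg_div, div_le_div_iff_of_pos_right hLipos]
      have := (abs_le.1 (hE x (by linarith))).1; linarith
    · filter_upwards [eventually_ge_atTop (256 : ℝ)] with x hx
      have hLipos : 0 < offsetLogIntegral x := lt_of_lt_of_le
        (div_pos (by linarith) (by have := Real.log_pos (by linarith : (1:ℝ) < x); positivity))
        (div_two_mul_log_le_offsetLogIntegral hx)
      rw [div_le_div_iff_of_pos_right hLipos]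
      exact (abs_le.1 (hE x (by linarith))).2
  -- conclusion for `Q'`, then for `Q`
  have hπlim : Tendsto (fun x ↦ πQ x / offsetLogIntegral x) atTop (𝓝 ((S.card : ℝ) / (2 * hcl))) := by
    have h1 := (hVlim.sub hElim).const_mul (1 / 2 : ℝ)
    rw [sub_zero] at h1
    convert h1 using 2 with x
    · ring
    · ring
  have hiff : Q.ProperEquiv (negForm Q) ↔ τ = τ⁻¹ := by
    rw [hτ, mk_eq_inv_iff_properEquiv_negForm b hb ι hι hf hQ' hQ'a]
    exact ⟨fun h => hQQ'.symm.trans (h.trans (RingClass.ProperEquiv.negForm hQQ')),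
      fun h => hQQ'.trans (h.trans (RingClass.ProperEquiv.negForm hQQ').symm)⟩
  have hfun : (fun x : ℝ ↦ (((((Finset.range (⌊x⌋₊ + 1)).filter Nat.Prime).filter
      (fun p : ℕ => ∃ a c : ℤ, Q.eval a c = (p : ℤ))).card : ℕ) : ℝ) / offsetLogIntegral x) =
      fun x ↦ πQ x / offsetLogIntegral x := by
    funext x
    rw [hπQ, filter_represented_eq_of_properEquiv hQQ']
  rw [hfun]
  convert hπlim using 2
  rw [← hcard]
  split_ifs with hequiv
  · have hτeq : τ = τ⁻¹ := hiff.mp hequiv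
    have hS1 : S = {τ} := by rw [hS, ← hτeq]; exact Finset.insert_eq_of_mem (Finset.mem_singleton_self τ)
    rw [hS1, Finset.card_singleton, Nat.cast_one]
  · have hne : τ ≠ τ⁻¹ := fun h => hequiv (hiff.mpr h)
    rw [hS, Finset.card_pair hne, Nat.cast_two]
    field_simp

end Summit.QuantumAdvantage.QuantumAdvantage.Theorems.DegreeOnePrimesEscape

end
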